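import Summits.AtomisticToContinuum.HydrodynamicLimit.Theorems.ImplosionDichotomyPolynomialCompressionEosUniformGasStep

/-!
# Uniform convergence of the insertion ratios of the uniform hard-sphere gas (stub `stub_eosRatioUniform`)

Crux `Summit.AtomisticToContinuum.HydrodynamicLimit.Theses.ImplosionDichotomy.PolynomialCompression`
(line `log-lipschitz-budget`), stub E2a `stub_eosRatioUniform`.

Let `Rf` solve the limit insertion equation `Rf x · Φ(x · Rf x) = 1`, `Φ(u) = ∑_j bE j uʲ / j!`,
with `1 ≤ Rf ≤ 2` and `Rf` Lipschitz on `[0, r]`. Then there is `η₂ ∈ (0, r]` such that for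
`0 < η < η₂` the insertion ratios `q_N(m) = Ξ_N(m)/Ξ_N(m+1)` (`qN`) of `N + 1` uniform hard
spheres of diameter `ε_N = η^{1/3} (N+1)^{-1/3}` on `𝕋³` satisfy
`sup_{m ≤ N} |q_N(m) - Rf(η m/(N+1))| → 0` as `N → ∞`.

## Proof

Put `σ = η^{1/3}` (`σ³ = η`), take `η₂ = min(r, σ₀³)` with `σ₀` from `exists_smallDensity`, so
that `SmallDensity uniformProfile σ` holds, in particular `4κ < 1`, `κ = contractionC`. Given
`δ > 0` put `c = 1 - 4κ > 0`, choose a cut-off `J` with `geomTail J ≤ cδ/16`, and then `N` large: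
`J ≤ N`, `J ε_N < 1/4` (the exact regime of `EosUniformGas.coefN_uniformProfile_eq`) and
`C/(N+1) ≤ cδ/2` for the explicit constant `C = 4 (e (J+1)³ + κ L J η + J geomTail 0)`. For such
`N` one proves `|q_N(m) - Rf(x_m)| ≤ δ`, `x_m = η m/(N+1)`, for ALL `m ≤ N` by strong induction
on the level `m`: at height `x_m ∈ [0, r]` the functional equation reads
`Rf(x_m)⁻¹ = ∑_j γ_j (m/(N+1))ʲ Rf(x_m)ʲ` (`γ_j = clusterCoeff σ j = ηʲ bE j / j!`); for
`i < K = min(J, m)` the induction hypothesis at level `m-1-i < m` and the Lipschitz bound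
`|Rf(x_{m-1-i}) - Rf(x_m)| ≤ L (i+1) η/(N+1) ≤ L J η/(N+1)` give
`|q_N(m-1-i) - Rf(x_m)| ≤ δ + L J η/(N+1) =: D`; the one-level estimate
`EosUniformGas.abs_inv_qN_sub_inv_le` and `|q - R| ≤ 4 |q⁻¹ - R⁻¹|` then give
`|q_N(m) - Rf(x_m)| ≤ 4κδ + C/(N+1) + 8 geomTail J ≤ 4κδ + cδ/2 + cδ/2 = δ`.

## References

* E. Pulvirenti, D. Tsagkarogiannis, *Cluster expansion in the canonical ensemble*, Comm. Math.
  Phys. 316 (2012) 289–306, Thm. 2.1, §5 (thermodynamic limit of the canonical free energy of the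
  homogeneous gas with periodic boundary conditions).
-/

namespace Summit.AtomisticToContinuum.HydrodynamicLimit.Theorems

open Set MeasureTheory Filter
open Literature.MathematicalPhysics.KineticTheory
open Literature.Analysis.FunctionSpaces
open scoped Topology

/-- **Uniform convergence of the insertion ratios at all heights** (stub `stub_eosRatioUniform`
of the line `log-lipschitz-budget`, crux `ImplosionDichotomy.PolynomialCompression`). For every
`Rf` solving `Rf x · Φ(x Rf x) = 1` (`Φ(u) = ∑_j bE j uʲ/j!`) with `1 ≤ Rf ≤ 2` and Lipschitz on
`[0, r]`, there is `η₂ ∈ (0, r]` such that for `0 < η < η₂` the insertion ratios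
`q_N(m) = Ξ_N(m)/Ξ_N(m+1)` of `N + 1` uniform hard spheres of diameter
`ε_N = η^{1/3} (N+1)^{-1/3}` on `𝕋³` satisfy `sup_{m ≤ N} |q_N(m) - Rf(η m/(N+1))| → 0` as
`N → ∞`. [folklore] -/
theorem stub_eosRatioUniform :
    ∀ (Rf : ℝ → ℝ) (r : ℝ), 0 < r →
      (∀ x ∈ Icc 0 r, 1 ≤ Rf x ∧ Rf x ≤ 2 ∧
        Rf x * (∑' j : ℕ, bE j / (j.factorial : ℝ) * (x * Rf x) ^ j) = 1) →
      (∃ L : NNReal, LipschitzOnWith L Rf (Icc 0 r)) →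
      ∃ η₂ : ℝ, 0 < η₂ ∧ η₂ ≤ r ∧ ∀ η ∈ Ioo 0 η₂, ∀ δ : ℝ, 0 < δ →
        ∀ᶠ N : ℕ in atTop, ∀ m : ℕ, m ≤ N →
          |qN uniformProfile (η ^ (1 / 3 : ℝ)) N m - Rf (η * m / (N + 1))| ≤ δ := by
  intro Rf r hr hRf hLip
  obtain ⟨L, hL⟩ := hLip
  obtain ⟨σ₀, hσ₀, hsmall⟩ := exists_smallDensity uniformProfile one_pos
  refine ⟨min r (σ₀ ^ 3), lt_min hr (pow_pos hσ₀ 3), min_le_left _ _, ?_⟩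
  rintro η ⟨hη0, hη2⟩ δ hδ
  have hηr : η < r := hη2.trans_le (min_le_left _ _)
  have hησ : η < σ₀ ^ 3 := hη2.trans_le (min_le_right _ _)
  -- the reduced density `σ = η^{1/3}`
  set σ : ℝ := η ^ (1 / 3 : ℝ) with hσ_def
  have hσpos : 0 < σ := Real.rpow_pos_of_pos hη0 _
  have hσ3 : σ ^ 3 = η := by
    rw [hσ_def, ← Real.rpow_natCast, ← Real.rpow_mul hη0.le]
    norm_num
  have hσlt : σ < σ₀ := lt_of_pow_lt_pow_left₀ 3 hσ₀.le (by rw [hσ3]; exact hησ)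
  have h : SmallDensity uniformProfile σ := (hsmall σ hσpos hσlt).1
  -- the contraction constant
  have hκ0 : 0 ≤ contractionC uniformProfile σ := h.contractionC_nonneg
  have hκ1 : 4 * contractionC uniformProfile σ < 1 := h.four_contractionC_lt_one
  set c : ℝ := 1 - 4 * contractionC uniformProfile σ with hc_def
  have hc : 0 < c := by rw [hc_def]; linarith
  have hL0 : (0 : ℝ) ≤ L := L.coe_nonneg
  have hT0 : 0 ≤ geomTail uniformProfile σ 0 := h.geomTail_nonneg 0
  -- the cut-off `J`: a small geometric tail
  have htail : Tendsto (fun J => geomTail uniformProfile σ J) atTop (𝓝 0) := by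
    have h1 := (tendsto_pow_atTop_nhds_zero_of_lt_one h.geomRatio_nonneg h.geomRatio_lt_one).comp
      (tendsto_add_atTop_nat 1)
    have h2 := h1.mul_const (Real.exp 1 / (1 - geomRatio uniformProfile σ))
    rw [zero_mul] at h2
    refine h2.congr fun J => ?_
    simp only [Function.comp_apply, geomTail]; ring
  obtain ⟨J, hJ⟩ := ((Metric.tendsto_nhds.mp htail) (c * δ / 16) (by positivity)).exists
  rw [Real.dist_eq, sub_zero, abs_of_nonneg (h.geomTail_nonneg J)] at hJ
  -- eventually in `N`: the exact regime, and the `O(1/N)` errors are small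
  set C : ℝ := 4 * (Real.exp 1 * ((J : ℝ) + 1) ^ 3 + contractionC uniformProfile σ * ((L : ℝ) * J * η) +
    (J : ℝ) * geomTail uniformProfile σ 0) with hC_def
  have hev1 : ∀ᶠ N : ℕ in atTop, J ≤ N := eventually_ge_atTop J
  have hev2 : ∀ᶠ N : ℕ in atTop, (J : ℝ) * hsDiameter σ N < 1 / 4 := by
    have h1 := (tendsto_hsDiameter σ).const_mul (J : ℝ)
    rw [mul_zero] at h1
    exact h1.eventually (gt_mem_nhds (by norm_num))
  have hev3 : ∀ᶠ N : ℕ in atTop, C / ((N : ℝ) + 1) ≤ c * δ / 2 := by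
    have h1 : Tendsto (fun N : ℕ => C / ((N : ℝ) + 1)) atTop (𝓝 0) := by
      have h2 := (tendsto_const_div_atTop_nhds_zero_nat C).comp (tendsto_add_atTop_nat 1)
      refine h2.congr fun N => ?_
      simp only [Function.comp_apply, Nat.cast_add, Nat.cast_one]
    exact h1.eventually_le_const (by positivity)
  filter_upwards [hev1, hev2, hev3] with N hJN hJε hCN
  have hN : (0 : ℝ) < (N : ℝ) + 1 := by positivity
  -- the heights `x_m = η m/(N+1) ∈ [0, r]`
  have hx : ∀ m : ℕ, m ≤ N → η * m / (N + 1) ∈ Icc 0 r := by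
    intro m hm
    refine ⟨by positivity, ?_⟩
    have hmN : (m : ℝ) ≤ (N : ℝ) + 1 := by exact_mod_cast Nat.le_succ_of_le hm
    have h1 : η * m / (N + 1) ≤ η := by
      rw [div_le_iff₀ hN]; nlinarith
    linarith
  -- strong induction on the level `m`
  suffices H : ∀ m : ℕ, m ≤ N → |qN uniformProfile σ N m - Rf (η * m / (N + 1))| ≤ δ from H
  intro m
  induction m using Nat.strong_induction_on with
  | _ m ih =>
    intro hm
    obtain ⟨hR1, hR2, hReq⟩ := hRf _ (hx m hm)
    set R : ℝ := Rf (η * m / (N + 1)) with hR_def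
    have hRpos : 0 < R := by linarith
    -- the limit equation at height `m`
    have hRe : R⁻¹ = ∑' j : ℕ, clusterCoeff σ j * ((m : ℝ) / ((N : ℝ) + 1)) ^ j * R ^ j := by
      rw [← EosUniformGas.tsum_bE_div_factorial_mul_pow_eq, hσ3]
      exact inv_eq_of_mul_eq_one_right hReq
    -- the cut-off at this level
    set K : ℕ := min J m with hK_def
    have hKJ : K ≤ J := min_le_left _ _
    have hKm : K ≤ m := min_le_right _ _
    have hK : J ≤ K ∨ m ≤ K := by
      rcases le_total J m with h' | h'
      · left; rw [hK_def, min_eq_left h']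
      · right; rw [hK_def, min_eq_right h']
    -- the induction hypothesis at the lower levels, moved to height `x_m` by the Lipschitz bound
    have hq : ∀ i < K, |qN uniformProfile σ N (m - 1 - i) - R| ≤ δ + L * J * (η / ((N : ℝ) + 1)) := by
      intro i hi
      have him : m - 1 - i < m := by omega
      have him' : m - 1 - i ≤ N := by omega
      have h1 := ih (m - 1 - i) him him'
      have h2 : |Rf (η * ((m - 1 - i : ℕ) : ℝ) / (N + 1)) - R| ≤ L * J * (η / ((N : ℝ) + 1)) := by
        have hd := hL.dist_le_mul _ (hx (m - 1 - i) him') _ (hx m hm)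
        rw [Real.dist_eq, Real.dist_eq] at hd
        refine hd.trans ?_
        have hcast : ((m - 1 - i : ℕ) : ℝ) = (m : ℝ) - 1 - i := by
          rw [Nat.cast_sub (by omega), Nat.cast_sub (by omega)]; push_cast; ring
        have habs : |η * ((m - 1 - i : ℕ) : ℝ) / (N + 1) - η * m / (N + 1)| =
            ((i : ℝ) + 1) * (η / ((N : ℝ) + 1)) := by
          rw [hcast, show η * ((m : ℝ) - 1 - i) / (N + 1) - η * m / (N + 1) =
            -(((i : ℝ) + 1) * (η / ((N : ℝ) + 1))) by ring, abs_neg, abs_of_nonneg (by positivity)]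
        rw [habs]
        have hiJ : (i : ℝ) + 1 ≤ J := by exact_mod_cast (show i + 1 ≤ J by omega)
        calc (L : ℝ) * (((i : ℝ) + 1) * (η / ((N : ℝ) + 1))) ≤ L * ((J : ℝ) * (η / ((N : ℝ) + 1))) := by
              gcongr
          _ = L * J * (η / ((N : ℝ) + 1)) := by ring
      calc |qN uniformProfile σ N (m - 1 - i) - R|
          ≤ |qN uniformProfile σ N (m - 1 - i) - Rf (η * ((m - 1 - i : ℕ) : ℝ) / (N + 1))| +
              |Rf (η * ((m - 1 - i : ℕ) : ℝ) / (N + 1)) - R| := abs_sub_le _ _ _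
        _ ≤ δ + L * J * (η / ((N : ℝ) + 1)) := add_le_add h1 h2
    -- the one-level estimate, and from inverses to the ratios
    have hD : 0 ≤ δ + L * J * (η / ((N : ℝ) + 1)) := by positivity
    have hest := EosUniformGas.abs_inv_qN_sub_inv_le h hm hJε hKJ hKm hK hR1 hR2 hRe hD hq
    have hq0 : 0 < qN uniformProfile σ N m := qN_pos h.σ_pos.le h.σ_lt_half h.ovDensity_lt_one hm
    have hq2 : qN uniformProfile σ N m ≤ 2 := h.qN_le_two hm
    have h4 := EosUniformGas.abs_sub_le_four_mul_abs_inv_sub_inv hq0 hq2 hRpos hR2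
    have hCN' : 4 * (Real.exp 1 * ((J : ℝ) + 1) ^ 3 / ((N : ℝ) + 1) +
        contractionC uniformProfile σ * ((L : ℝ) * J * (η / ((N : ℝ) + 1))) +
          (J : ℝ) / ((N : ℝ) + 1) * geomTail uniformProfile σ 0) = C / ((N : ℝ) + 1) := by
      rw [hC_def]
      field_simp
    refine h4.trans ?_
    calc 4 * |(qN uniformProfile σ N m)⁻¹ - R⁻¹|
        ≤ 4 * (Real.exp 1 * ((J : ℝ) + 1) ^ 3 / ((N : ℝ) + 1) +
            contractionC uniformProfile σ * (δ + L * J * (η / ((N : ℝ) + 1))) +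
              2 * geomTail uniformProfile σ J + (J : ℝ) / ((N : ℝ) + 1) * geomTail uniformProfile σ 0) :=
          mul_le_mul_of_nonneg_left hest (by norm_num)
      _ = 4 * contractionC uniformProfile σ * δ + C / ((N : ℝ) + 1) + 8 * geomTail uniformProfile σ J := by
          rw [← hCN']; ring
      _ ≤ 4 * contractionC uniformProfile σ * δ + c * δ / 2 + 8 * (c * δ / 16) := by
          gcongr
      _ = δ := by rw [hc_def]; ring

end Summit.AtomisticToContinuum.HydrodynamicLimit.Theorems
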